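import Summits.ResolutionOfSingularities.ResolutionOfSingularities.Theorems.FrobeniusClosingSteerMinimalDegreeRegular
import HarnessLib

/-!
# Crux `Steer` (stmt-ResolutionOfSingularities-16345), chain W4.1 — K-I2 FILE A: **LOCAL BEZOUT in `M = K[T,U]`**
# (`moduleFinite_quotient_of_pow_le`, `mul_finrank_le_finrank_quotient_sup_pow`, `mem_of_mem_pow_of_totalDegree_le`)

OURS (campaign `res-hironaka`, rung L ★L-G4, slot W4.1; the I″ kernel `LemmaI.NonRationalStepNotIsolated` by derivations + Cramer, res-L0-w41-idea-3
blueprint `K-I2-BLUEPRINT.md` / signatures `K-I2_signatures.lean` e62c805738af0a97 §FILE A, statements VERBATIM; seat res-D-pv-053 g9 on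
res-L0-w41-plan-1 RULING 274 (a)). Candidates, not facts; nothing here is a statement of H. Hironakaʼs manuscript [Hironaka2017] (status: under
review). AI-written; AI review is weaker than expert review. Theses-free, definition-free commutative algebra over an ARBITRARY field `K`.

Let `A = K[X₀,X₁]`, `𝔫 ⊂ A` a maximal ideal with residue degree `q = dim_K A⧸𝔫`.
* (A0) `moduleFinite_quotient_of_pow_le` — an ideal `I ⊇ 𝔫^N` has finite codimension: `𝔫` contains a RELATIVELY PRIME pair `f, g` (R2: the
  minimal-degree element `f` is irreducible, and there is room for a non-multiple `g ∈ 𝔫`), so `A⧸(f^N, g^N)` is finite-dimensional (R1, the plane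
  Bézout inequality) and surjects onto `A⧸I`.
* (A1) `mul_finrank_le_finrank_quotient_sup_pow` — `N·q ≤ dim_K A⧸((h₁) + 𝔫^N)` for `h₁ ∈ 𝔫`: induction on `N`; the kernel of
  `A⧸((h₁)+𝔫^{N+1}) ↠ A⧸((h₁)+𝔫^N)` has dimension `≥ q` by rank–nullity for the multiplication by some `m ∈ 𝔫^N ∖ ((h₁)+𝔫^{N+1})`, which exists by
  Nakayama + Krull (`not_pow_le_span_sup_pow_succ`: otherwise `𝔫` is minimal over `(h₁)`, of height `≤ 1`, but `ht 𝔫 = 2`).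
* (A2) `mem_of_mem_pow_of_totalDegree_le` — LOCAL BEZOUT: `Ψ ∈ 𝔫^N` of degree `≤ D`, a prime `𝔭 ≤ 𝔫` containing some `h ≠ 0` of degree `≤ δ′`,
  and `δ′·D < N·q` force `Ψ ∈ 𝔭` (else a prime factor `h₁ ∈ 𝔭` of `h` is prime to `Ψ`, and R1 bounds `dim A⧸(h₁,Ψ) ≤ δ′·D` while (A1) bounds it
  below by `N·q`).
[cite: Kunz2005PlaneAlgebraicCurves, App. A Lemma A.11] [cite: Matsumura1987, Thm. 13.5, Thm. 2.2] [folklore]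
-/

noncomputable section

-- `Summit.<S>.<S>.…` duplicates the summit name by design (single-problem summit).
set_option linter.dupNamespace false

open IsLocalRing Module MvPolynomial

namespace Summit.ResolutionOfSingularities.ResolutionOfSingularities.Theorems.SwitchingDichotomy.LemmaI2

open Summit.ResolutionOfSingularities.ResolutionOfSingularities.Theorems.SwitchingDichotomy.ClaimR
  (exists_mem_notMem_sq exists_mem_notMem_span_of_lt finite_quotient_span_pair finrank_quotient_span_pair_le totalDegree_pos_of_mem)

variable {K : Type} [Field K]

/-! ## §1 (A0) finite codimension of ideals containing a power of a maximal ideal -/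

/-- A relatively prime pair stays relatively prime after raising both to powers. [folklore] -/
private theorem isRelPrime_pow_pow {f g : MvPolynomial (Fin 2) K} (h : IsRelPrime f g) (m n : ℕ) :
    IsRelPrime (f ^ m) (g ^ n) := by
  have h1 : IsRelPrime (f ^ m) g := by
    induction m with
    | zero => rw [pow_zero]; exact isRelPrime_one_left
    | succ m ih => rw [pow_succ]; exact ih.mul_left h
  induction n with
  | zero => rw [pow_zero]; exact isRelPrime_one_right
  | succ n ih => rw [pow_succ]; exact ih.mul_right h1

/-- **(A0) finiteness**: an ideal of `K[T,U]` containing a power `𝔫^N` of a maximal ideal `𝔫` has finite codimension over `K`.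
(`𝔫` contains a relatively prime pair `f, g` — the minimal-degree element is irreducible and there is room for a non-multiple — so `A⧸(f^N, g^N)` is
finite by the plane Bézout inequality and surjects onto `A⧸I`.) [cite: Kunz2005PlaneAlgebraicCurves, App. A Lemma A.11] [folklore] -/
theorem moduleFinite_quotient_of_pow_le (𝔫 : Ideal (MvPolynomial (Fin 2) K)) [𝔫.IsMaximal] {I : Ideal (MvPolynomial (Fin 2) K)}
    {N : ℕ} (hI : 𝔫 ^ N ≤ I) : Module.Finite K (MvPolynomial (Fin 2) K ⧸ I) := by
  classical
  letI := Ideal.Quotient.field 𝔫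
  haveI : Module.Finite K (MvPolynomial (Fin 2) K ⧸ 𝔫) := finite_of_finite_type_of_isJacobsonRing K _
  set q := finrank K (MvPolynomial (Fin 2) K ⧸ 𝔫) with hq
  -- an irreducible `f ∈ 𝔫` of degree `δ ≥ 1`
  obtain ⟨δ, f, hδ, hf𝔫, -, hf0, hfdeg, hirr, -⟩ := exists_mem_notMem_sq 𝔫
  -- room for a non-multiple `g ∈ 𝔫` in degree `e := q + deg f`
  have ht : 0 < f.totalDegree := totalDegree_pos_of_mem (Ideal.IsMaximal.ne_top ‹_›) hf0 hf𝔫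
  have hroom : q + (q + f.totalDegree + 2 - f.totalDegree).choose 2 < (q + f.totalDegree + 2).choose 2 := by
    have h2 : (q + 3).choose 2 ≤ (q + f.totalDegree + 2).choose 2 := Nat.choose_le_choose 2 (by omega)
    have h3 : (q + 3).choose 2 = (q + 2) + (q + 2).choose 2 := by
      rw [Nat.choose_succ_succ', Nat.choose_one_right]
    rw [show q + f.totalDegree + 2 - f.totalDegree = q + 2 by omega]
    omega
  obtain ⟨g, hg𝔫, -, hfg⟩ := exists_mem_notMem_span_of_lt 𝔫 hf0 hroom
  have hg0 : g ≠ 0 := by rintro rfl; exact hfg (dvd_zero f)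
  have hrel : IsRelPrime f g := (hirr.dvd_or_isRelPrime).resolve_left hfg
  -- `A ⧸ (f^N, g^N)` is finite and surjects onto `A ⧸ I`
  haveI := finite_quotient_span_pair (pow_ne_zero N hf0) (pow_ne_zero N hg0) (isRelPrime_pow_pow hrel N N)
  have hle : Ideal.span {f ^ N, g ^ N} ≤ I := by
    rw [Ideal.span_le]
    rintro x (rfl | rfl)
    · exact hI (Ideal.pow_mem_pow hf𝔫 N)
    · exact hI (Ideal.pow_mem_pow hg𝔫 N)
  let θ : (MvPolynomial (Fin 2) K ⧸ Ideal.span {f ^ N, g ^ N}) →ₐ[K] (MvPolynomial (Fin 2) K ⧸ I) := Ideal.Quotient.factorₐ K hle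
  exact Module.Finite.of_surjective θ.toLinearMap (Ideal.Quotient.factor_surjective hle)

/-! ## §2 (A1) the length count `N · q ≤ dim_K A⧸((h₁) + 𝔫^N)` -/

/-- **Nakayama + Krull for powers**: for `h₁ ∈ 𝔫` (maximal ideal of `K[T,U]`, of height two), `𝔫^N ⊄ (h₁) + 𝔫^{N+1}`. Otherwise Nakayama applied to the
image of `𝔫^N` in `A⧸(h₁)` gives `r ≡ 1 (mod 𝔫)` with `r·𝔫^N ⊆ (h₁)`, so `𝔫` is a minimal prime of `(h₁)` and Krullʼs principal ideal theorem bounds its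
height by one. [cite: Matsumura1987, Thm. 13.5, Thm. 2.2 (Nakayama)] [folklore] -/
theorem not_pow_le_span_sup_pow_succ (𝔫 : Ideal (MvPolynomial (Fin 2) K)) [h𝔫 : 𝔫.IsMaximal]
    {h₁ : MvPolynomial (Fin 2) K} (hh : h₁ ∈ 𝔫) (N : ℕ) : ¬ 𝔫 ^ N ≤ Ideal.span {h₁} ⊔ 𝔫 ^ (N + 1) := by
  intro hle
  -- Nakayama for the image `Q` of `𝔫^N` in `A ⧸ (h₁)`: `Q ≤ 𝔫 • Q`
  let Q : Submodule (MvPolynomial (Fin 2) K) (MvPolynomial (Fin 2) K ⧸ Ideal.span {h₁}) :=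
    Submodule.map (Ideal.span {h₁}).mkQ (𝔫 ^ N)
  have hQfg : Q.FG := (IsNoetherian.noetherian (𝔫 ^ N)).map _
  have hQle : Q ≤ 𝔫 • Q := by
    rintro x ⟨m, hm, rfl⟩
    obtain ⟨y, hy, z, hz, hyz⟩ := Submodule.mem_sup.1 (hle hm)
    have hy0 : (Ideal.span {h₁}).mkQ y = 0 := by
      rw [Submodule.mkQ_apply, Submodule.Quotient.mk_eq_zero]; exact hy
    have hmz : (Ideal.span {h₁}).mkQ m = (Ideal.span {h₁}).mkQ z := by
      rw [← hyz, map_add, hy0, zero_add]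
    rw [hmz]
    rw [pow_succ'] at hz
    refine Submodule.mul_induction_on hz (fun a ha b hb => ?_) (fun a b ha hb => ?_)
    · rw [← smul_eq_mul, map_smul]
      exact Submodule.smul_mem_smul ha (Submodule.mem_map_of_mem hb)
    · rw [map_add]; exact add_mem ha hb
  obtain ⟨r, hr1, hrQ⟩ := Submodule.exists_sub_one_mem_and_smul_eq_zero_of_fg_of_le_smul 𝔫 Q hQfg hQle
  -- hence `r · 𝔫^N ⊆ (h₁)` with `r ∉ 𝔫`
  have hrm : ∀ m ∈ 𝔫 ^ N, r * m ∈ Ideal.span {h₁} := by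
    intro m hm
    have h := hrQ _ (Submodule.mem_map_of_mem (f := (Ideal.span {h₁}).mkQ) hm)
    rwa [Submodule.mkQ_apply, ← Submodule.Quotient.mk_smul, Submodule.Quotient.mk_eq_zero, smul_eq_mul] at h
  have hr : r ∉ 𝔫 := by
    intro h
    apply h𝔫.ne_top
    rw [Ideal.eq_top_iff_one]
    have : r - (r - 1) ∈ 𝔫 := sub_mem h hr1
    rwa [sub_sub_cancel] at this
  -- so `𝔫` is a minimal prime of `(h₁)`, of height `≤ 1`; but `ht 𝔫 = 2`
  have hmin : 𝔫 ∈ (Ideal.span {h₁}).minimalPrimes := by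
    refine ⟨⟨h𝔫.isPrime, (Ideal.span_singleton_le_iff_mem _).2 hh⟩, ?_⟩
    rintro P ⟨hP, hgP⟩ hP𝔫
    have hPN : 𝔫 ^ N ≤ P := fun m hm =>
      (hP.mem_or_mem (hgP (hrm m hm))).resolve_left fun hrP => hr (hP𝔫 hrP)
    intro x hx
    exact hP.mem_of_pow_mem N (hPN (Ideal.pow_mem_pow hx N))
  have h1 := Ideal.height_le_one_of_isPrincipal_of_mem_minimalPrimes (Ideal.span {h₁}) 𝔫 hmin
  rw [Literature.AlgebraicGeometry.Resolution.MvPolynomial.height_eq_of_isMaximal K 2 𝔫] at h1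
  norm_num at h1

/-- **(A1) LENGTH COUNT: `N · [M/𝔫 : K] ≤ dim_K M/((h₁) + 𝔫^N)`** for `0 ≠ h₁ ∈ 𝔫` (the graded pieces `((h₁)+𝔫^i)/((h₁)+𝔫^{i+1})`, `i < N`, are
nonzero `M/𝔫`-spaces: Krull / Nakayama in the 2-dimensional regular local ring `M_𝔫`, where `M_𝔫/(h₁)` has dimension 1). [cite: Matsumura1987, Thm. 13.4] [folklore] -/
theorem mul_finrank_le_finrank_quotient_sup_pow (𝔫 : Ideal (MvPolynomial (Fin 2) K)) [𝔫.IsMaximal]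
    {h₁ : MvPolynomial (Fin 2) K} (hh : h₁ ∈ 𝔫) (hh0 : h₁ ≠ 0) (N : ℕ) :
    N * finrank K (MvPolynomial (Fin 2) K ⧸ 𝔫) ≤ finrank K (MvPolynomial (Fin 2) K ⧸ (Ideal.span {h₁} ⊔ 𝔫 ^ N)) := by
  classical
  have _ := hh0
  induction N with
  | zero => simp
  | succ N ih =>
    set J := Ideal.span {h₁} ⊔ 𝔫 ^ N with hJ
    set J' := Ideal.span {h₁} ⊔ 𝔫 ^ (N + 1) with hJ'
    haveI hfin' : Module.Finite K (MvPolynomial (Fin 2) K ⧸ J') := moduleFinite_quotient_of_pow_le 𝔫 le_sup_right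
    have hJ'J : J' ≤ J := sup_le_sup_left (Ideal.pow_le_pow_right (Nat.le_succ N)) _
    have hJ'𝔫 : J' ≤ 𝔫 := sup_le ((Ideal.span_singleton_le_iff_mem _).2 hh) (Ideal.pow_le_self (Nat.succ_ne_zero N))
    -- an element of `𝔫^N` outside `J'`
    obtain ⟨m, hmN, hmJ'⟩ := Set.not_subset.1 (not_pow_le_span_sup_pow_succ 𝔫 hh N)
    -- the three `K`-linear maps: `π : A⧸J' → A⧸J`, `ρ : A⧸J' → A⧸𝔫`, `μ = · m̄` on `A⧸J'`
    let π : (MvPolynomial (Fin 2) K ⧸ J') →ₐ[K] (MvPolynomial (Fin 2) K ⧸ J) := Ideal.Quotient.factorₐ K hJ'J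
    have hπs : Function.Surjective π := Ideal.Quotient.factor_surjective hJ'J
    let ρ : (MvPolynomial (Fin 2) K ⧸ J') →ₐ[K] (MvPolynomial (Fin 2) K ⧸ 𝔫) := Ideal.Quotient.factorₐ K hJ'𝔫
    have hρs : Function.Surjective ρ := Ideal.Quotient.factor_surjective hJ'𝔫
    let μ : (MvPolynomial (Fin 2) K ⧸ J') →ₗ[K] (MvPolynomial (Fin 2) K ⧸ J') := LinearMap.mulRight K (Ideal.Quotient.mk J' m)
    have hπmk : ∀ a, π (Ideal.Quotient.mk J' a) = Ideal.Quotient.mk J a := fun _ => rfl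
    have hρmk : ∀ a, ρ (Ideal.Quotient.mk J' a) = Ideal.Quotient.mk 𝔫 a := fun _ => rfl
    have hμ : ∀ x, μ x = x * Ideal.Quotient.mk J' m := fun _ => rfl
    -- `range μ ≤ ker π` (`a m ∈ 𝔫^N ⊆ J`)
    have h1 : LinearMap.range μ ≤ LinearMap.ker π.toLinearMap := by
      rintro x ⟨y, rfl⟩
      obtain ⟨a, rfl⟩ := Ideal.Quotient.mk_surjective y
      rw [LinearMap.mem_ker, AlgHom.toLinearMap_apply, hμ, ← map_mul, hπmk, Ideal.Quotient.eq_zero_iff_mem]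
      exact Ideal.mem_sup_right (Ideal.mul_mem_left _ a hmN)
    -- `ker μ ≤ ker ρ` (if `a m ∈ J'` with `a ∉ 𝔫` then `m ∈ J'`)
    have h2 : LinearMap.ker μ ≤ LinearMap.ker ρ.toLinearMap := by
      intro x hx
      obtain ⟨a, rfl⟩ := Ideal.Quotient.mk_surjective x
      rw [LinearMap.mem_ker, hμ, ← map_mul, Ideal.Quotient.eq_zero_iff_mem] at hx
      rw [LinearMap.mem_ker, AlgHom.toLinearMap_apply, hρmk, Ideal.Quotient.eq_zero_iff_mem]
      by_contra ha
      obtain ⟨b, i, hi, hbi⟩ := Ideal.IsMaximal.exists_inv ‹𝔫.IsMaximal› ha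
      apply hmJ'
      have hm' : m = b * (a * m) + i * m := by rw [← mul_assoc, ← add_mul, hbi, one_mul]
      rw [hm']
      refine J'.add_mem (J'.mul_mem_left b hx) (Ideal.mem_sup_right ?_)
      rw [pow_succ']
      exact Ideal.mul_mem_mul hi hmN
    -- rank–nullity bookkeeping
    have hrnπ := LinearMap.finrank_range_add_finrank_ker π.toLinearMap
    have hrnρ := LinearMap.finrank_range_add_finrank_ker ρ.toLinearMap
    have hrnμ := LinearMap.finrank_range_add_finrank_ker μ
    have hrangeπ : finrank K (LinearMap.range π.toLinearMap) = finrank K (MvPolynomial (Fin 2) K ⧸ J) := by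
      rw [LinearMap.range_eq_top.2 hπs, finrank_top]
    have hrangeρ : finrank K (LinearMap.range ρ.toLinearMap) = finrank K (MvPolynomial (Fin 2) K ⧸ 𝔫) := by
      rw [LinearMap.range_eq_top.2 hρs, finrank_top]
    have h1' := Submodule.finrank_mono h1
    have h2' := Submodule.finrank_mono h2
    have ih' := ih
    rw [Nat.succ_mul]
    omega

/-! ## §3 (A2) LOCAL BEZOUT -/

/-- **(A2) LOCAL BEZOUT**: `Ψ ∈ 𝔫^N`, `deg Ψ ≤ D`, a prime `𝔭 ≤ 𝔫` containing some `h ≠ 0` of degree `≤ δ'`, and `δ'·D < N·[M/𝔫 : K]`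
force `Ψ ∈ 𝔭` (else pick an irreducible factor `h₁ ∈ 𝔭` of `h`; `h₁ ∤ Ψ`, so `h₁, Ψ` are coprime and R1 bounds `dim_K M/(h₁, Ψ) ≤ δ'·D`, while
`(h₁, Ψ) ⊆ (h₁) + 𝔫^N` and (A1)). With `𝔭 = 𝔫` the statement is trivial (`N ≥ 1`). [cite: Kunz2005PlaneAlgebraicCurves, App. A Lemma A.11] [folklore] -/
theorem mem_of_mem_pow_of_totalDegree_le (𝔫 : Ideal (MvPolynomial (Fin 2) K)) [𝔫.IsMaximal]
    (𝔭 : Ideal (MvPolynomial (Fin 2) K)) [𝔭.IsPrime] (h𝔭𝔫 : 𝔭 ≤ 𝔫)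
    {h Ψ : MvPolynomial (Fin 2) K} (hh : h ∈ 𝔭) (hh0 : h ≠ 0) {δ' D N : ℕ}
    (hdeg : h.totalDegree ≤ δ') (hΨ : Ψ ∈ 𝔫 ^ N) (hdegΨ : Ψ.totalDegree ≤ D)
    (hineq : δ' * D < N * finrank K (MvPolynomial (Fin 2) K ⧸ 𝔫)) : Ψ ∈ 𝔭 := by
  classical
  by_cases hΨ0 : Ψ = 0
  · rw [hΨ0]; exact 𝔭.zero_mem
  -- a prime factor `h₁ ∈ 𝔭` of `h`
  obtain ⟨u, hu⟩ := UniqueFactorizationMonoid.factors_prod hh0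
  have hprod : (UniqueFactorizationMonoid.factors h).prod ∈ 𝔭 := by
    have e : (UniqueFactorizationMonoid.factors h).prod = h * ↑u⁻¹ := by
      rw [← Units.mul_inv_cancel_right (UniqueFactorizationMonoid.factors h).prod u, hu]
    rw [e]
    exact 𝔭.mul_mem_right _ hh
  obtain ⟨h₁, hh₁f, hh₁𝔭⟩ := (Ideal.IsPrime.multiset_prod_mem_iff_exists_mem ‹𝔭.IsPrime› _).mp hprod
  have hp₁ : Prime h₁ := UniqueFactorizationMonoid.prime_of_factor h₁ hh₁f
  have hh₁0 : h₁ ≠ 0 := hp₁.ne_zero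
  have hh₁h : h₁ ∣ h := UniqueFactorizationMonoid.dvd_of_mem_factors hh₁f
  have hdeg₁ : h₁.totalDegree ≤ δ' := by
    obtain ⟨c, hc⟩ := hh₁h
    have hc0 : c ≠ 0 := by rintro rfl; exact hh0 (by rw [hc, mul_zero])
    have := totalDegree_mul_of_isDomain hh₁0 hc0
    rw [← hc] at this
    omega
  by_contra hΨ𝔭
  -- `h₁ ∤ Ψ`, so `h₁, Ψ` are relatively prime; R1 bounds `dim A⧸(h₁, Ψ)` above
  have hndvd : ¬ h₁ ∣ Ψ := by
    rintro ⟨c, rfl⟩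
    exact hΨ𝔭 (𝔭.mul_mem_right c hh₁𝔭)
  have hrel : IsRelPrime h₁ Ψ := (hp₁.irreducible.dvd_or_isRelPrime).resolve_left hndvd
  haveI := finite_quotient_span_pair hh₁0 hΨ0 hrel
  have hup : finrank K (MvPolynomial (Fin 2) K ⧸ Ideal.span {h₁, Ψ}) ≤ δ' * D :=
    (finrank_quotient_span_pair_le hh₁0 hΨ0 hrel).trans (Nat.mul_le_mul hdeg₁ hdegΨ)
  -- `(h₁, Ψ) ≤ J := (h₁) + 𝔫^N`, so `A ⧸ J` is a quotient of `A ⧸ (h₁, Ψ)`; (A1) bounds `dim A⧸J` below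
  have hlow := mul_finrank_le_finrank_quotient_sup_pow 𝔫 (h𝔭𝔫 hh₁𝔭) hh₁0 N
  set J : Ideal (MvPolynomial (Fin 2) K) := Ideal.span {h₁} ⊔ 𝔫 ^ N with hJ
  have hIJ : Ideal.span {h₁, Ψ} ≤ J := by
    rw [Ideal.span_le]
    rintro x (rfl | rfl)
    · exact Ideal.mem_sup_left (Ideal.mem_span_singleton_self _)
    · exact Ideal.mem_sup_right hΨ
  let θ : (MvPolynomial (Fin 2) K ⧸ Ideal.span {h₁, Ψ}) →ₐ[K] (MvPolynomial (Fin 2) K ⧸ J) := Ideal.Quotient.factorₐ K hIJ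
  have hθs : Function.Surjective θ := Ideal.Quotient.factor_surjective hIJ
  haveI : Module.Finite K (MvPolynomial (Fin 2) K ⧸ J) := Module.Finite.of_surjective θ.toLinearMap hθs
  have hθle : finrank K (MvPolynomial (Fin 2) K ⧸ J) ≤ finrank K (MvPolynomial (Fin 2) K ⧸ Ideal.span {h₁, Ψ}) := by
    have h := LinearMap.finrank_range_le θ.toLinearMap
    rwa [LinearMap.range_eq_top.2 hθs, finrank_top] at h
  omega

end Summit.ResolutionOfSingularities.ResolutionOfSingularities.Theorems.SwitchingDichotomy.LemmaI2

end
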